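import Literature.InformationTheory.Entropy.VonNeumannEntropySubadditivity
import Literature.LinearAlgebra.Matrix.StinespringRepresentations
import HarnessLib

/-!
# Monotonicity of the quantum relative entropy under channels (Watrous 2018, Theorem 5.35;
# Lindblad 1975) — positive semidefinite pairs with nested supports

Topic `InformationTheory/Entropy`, namespace `Literature.InformationTheory.Entropy`. The tree proved Lindblad's
monotonicity `D(Tr_A ρ ‖ Tr_A σ) ≤ D(ρ‖σ)` for POSITIVE DEFINITE `ρ, σ` (`RelativeEntropyMonotonicity`,
Petz's proof) and for a density `ρ` against a positive definite density `σ`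
(`RelativeEntropyMonotonicityDensity`, the named fact `relEntropy_partialTrace_le`); its docstring left
«TODO(general form): … general trace-preserving completely positive maps (Lindblad 1975, Theorem)». This file
supplies that general form in the finite-dimensional setting of the source, for every channel in KRAUS FORM
`Φ(X) = Σ_s A_s X A_s⋆`, `Σ_s A_s⋆ A_s = 𝟙`, and every pair `ρ, σ ⪰ 0` with `ker σ ⊆ ker ρ` — the case in
which Watrous' `D(ρ‖σ)` (Definition 5.18) is finite and agrees with the tree's `quantumRelEntropy` (cfc-log,
`log 0 = 0`); no normalisation of the traces is needed. Everything is PROVED; no definition, no named fact.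

* §1 **Regularisation limits.** `Tr(P log(σ + ε𝟙)) = Σ_k log(μ_k + ε)(W⋆PW)_{kk}` in the eigenbasis of `σ`
  (`trace_mul_log_add_smul_one_eq_sum`); when `ker σ ⊆ ker P` the weights on `μ_k = 0` vanish, so
  `ε ↦ Tr(P log(σ+ε𝟙))` is continuous at `0` and **`D(P ‖ σ + ε𝟙) → D(P‖σ)`** (`tendsto_re_trace_mul_log_add_smul_one`,
  `tendsto_quantumRelEntropy_add_smul_one_right`); and **`D(ρ + δ𝟙 ‖ Q) → D(ρ‖Q)`** for every `Q`
  (`tendsto_quantumRelEntropy_add_smul_one_left`, `t log t` continuous). [cite: Watrous2018, Definition 5.18, eqs. (5.87)–(5.88), (5.92)]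
* §2 **Partial traces**: `Tr_X(ρ + c𝟙) = Tr_X ρ + c|X|𝟙` (`traceLeft/Right_add_smul_one`, `traceLeft/Right_one`),
  the support transfer `ker(Tr σ) ⊆ ker(Tr ρ)` (`ker_traceLeft_le`, `ker_traceRight_le`, from the marginal
  support lemmas of `VonNeumannEntropySubadditivity`), and **`D(Tr_X ρ ‖ Tr_X σ) ≤ D(ρ‖σ)`,
  `D(Tr_Y ρ ‖ Tr_Y σ) ≤ D(ρ‖σ)` for `ρ, σ ⪰ 0` with `ker σ ⊆ ker ρ`**
  (`quantumRelEntropy_traceLeft_le_of_ker_le`, `quantumRelEntropy_traceRight_le_of_ker_le`,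
  `quantumRelEntropy_partialTrace_le_of_ker_le`): the tree's positive definite inequality at
  `(ρ + δ𝟙, σ + ε𝟙)`, then `δ → 0⁺`, then `ε → 0⁺`. [cite: Lindblad1975, Lemma 2 p.149]
  [cite: NielsenChuang2010, Theorem 11.17]
* §3 **Theorem 5.35**: `D(Φ(ρ)‖Φ(σ)) ≤ D(ρ‖σ)` (`quantumRelEntropy_kraus_le`; densities with `σ ≻ 0`:
  `quantumRelEntropy_kraus_le_of_posDef`), by the printed Stinespring route (5.175)–(5.179) with `Tr_𝒵` in
  place of `𝟙 ⊗ Ω`: the stacked isometry `A = Σ_s A_s ⊗ e_s` of the tree's `StinespringRepresentations`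
  (`Φ(X) = Tr_𝒵(AXA⋆)`, `A⋆A = 𝟙`), the isometric invariance `D(AρA⋆‖AσA⋆) = D(ρ‖σ)` of `KleinInequality`
  (Proposition 5.19), the support transfer `ker(AσA⋆) ⊆ ker(AρA⋆)` (`ker_conj_le`), and §2.
  [cite: Watrous2018, Theorem 5.35] [cite: Lindblad1975, Theorem p.149]

## Tree / Mathlib search (2026-08-31)

REUSED, not restated: `re_trace_traceLeft_mul_log_sub_log_le` (PD case), `trace_submatrix_mul_log_sub_log`,
`traceLeft_submatrix_swap` (`RelativeEntropyMonotonicity(Density)`), `quantumRelEntropy_isometry_conj`,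
`trace_mul_cfc_eq_sum`, `ker_le_of_posDef` (`KleinInequality`), `mulVec_prod_eq_zero_of_traceLeft/Right`,
`mulVec_col_of_conj_diagonal` (`VonNeumannEntropySubadditivity`), `traceRight_stack_mul_mul_conjTranspose_stack`,
`stinespring_isometry_iff` (`LinearAlgebra/Matrix/StinespringRepresentations`), `traceLeft/Right_add/smul/kronecker`,
`posSemidef_traceLeft/Right` (`QuantumLattice/KroneckerPartialTrace`), `cfc_eq_conj_diagonal`, `trace_unitary_conj`.
`rg -n "TODO\(general form\)|trace-preserving completely positive"` over the Entropy files → only the TODO in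
`VonNeumannEntropyInequalities`; `rg "kraus.*quantumRelEntropy|quantumRelEntropy.*kraus|_of_ker_le"` → nothing
before this series. Mathlib: `Matrix.PosSemidef.mul_mul_conjTranspose_same`, `Matrix.PosSemidef.dotProduct_mulVec_zero_iff`,
`Matrix.star_mulVec`, `Matrix.dotProduct_mulVec`, `Real.continuousAt_log`, `Real.continuous_mul_log`,
`tendsto_nhdsWithin_of_tendsto_nhds_of_eventually_within`, `le_of_tendsto_of_tendsto`.

## References

* J. Watrous, *The Theory of Quantum Information* (CUP 2018), §5.2.1 Definition 5.18, §5.2.3 Theorem 5.35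
  (eqs. (5.174)–(5.179)). [Watrous2018]
* G. Lindblad, *Completely positive maps and entropy inequalities*, Commun. Math. Phys. 40 (1975) 147–151,
  Lemma 2 and Theorem. [Lindblad1975]
* M. A. Nielsen, I. L. Chuang, *Quantum Computation and Quantum Information* (CUP 2010), Theorem 11.17,
  §11.3.6. [NielsenChuang2010]
-/

noncomputable section

open Matrix Filter Topology
open scoped BigOperators ComplexOrder Kronecker

namespace Literature.InformationTheory.Entropy

open Literature.Computability.QuantumComplexity (traceLeft traceRight IsDensity traceLeft_apply
  traceRight_apply trace_traceLeft trace_traceRight)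
open Literature.LinearAlgebra.Matrix (cfc_eq_conj_diagonal trace_unitary_conj isHermitian_cfc)
open Literature.MathematicalPhysics.QuantumLattice (traceLeft_add traceLeft_smul traceRight_add
  traceRight_smul traceLeft_kronecker traceRight_kronecker posSemidef_traceLeft posSemidef_traceRight)
open Literature.LinearAlgebra.Matrix.StinespringRepresentations (traceRight_stack_mul_mul_conjTranspose_stack
  stinespring_isometry_iff)

variable {d : Type*} [Fintype d] [DecidableEq d]

/-! ### §1 Continuity of `D(P ‖ σ + ε𝟙)` at `ε = 0` under `ker σ ⊆ ker P` -/

section Continuity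

/-- Shifting a unitary diagonalisation: `P + c𝟙 = V diag(λ + c) V⋆`. [folklore] -/
private theorem conj_diagonal_add_smul_one {P V : Matrix d d ℂ} (hV : V ∈ Matrix.unitaryGroup d ℂ)
    {lam : d → ℝ} (hPV : P = V * diagonal (fun j => ((lam j : ℝ) : ℂ)) * star V) (c : ℝ) :
    P + ((c : ℝ) : ℂ) • (1 : Matrix d d ℂ) = V * diagonal (fun j => ((lam j + c : ℝ) : ℂ)) * star V := by
  have h1 : ((c : ℝ) : ℂ) • (1 : Matrix d d ℂ) = V * diagonal (fun _ : d => ((c : ℝ) : ℂ)) * star V := by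
    rw [← Matrix.smul_one_eq_diagonal, Matrix.mul_smul, Matrix.mul_one, Matrix.smul_mul,
      Unitary.mul_star_self_of_mem hV]
  have hd : diagonal (fun j => ((lam j + c : ℝ) : ℂ)) =
      diagonal (fun j => ((lam j : ℝ) : ℂ)) + diagonal (fun _ : d => ((c : ℝ) : ℂ)) := by
    rw [diagonal_add]; congr 1; funext j; push_cast; rfl
  rw [hPV, h1, hd, Matrix.mul_add, Matrix.add_mul]

/-- `Tr (P · U D U⋆) = Σ_p D_p (U⋆ P U)_{pp}` (plumbing). [folklore] -/
private theorem trace_mul_conj_diagonal_eq_sum' (P U : Matrix d d ℂ) (hU : U ∈ Matrix.unitaryGroup d ℂ)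
    (g : d → ℂ) : (P * (U * diagonal g * star U)).trace = ∑ p, g p * (star U * P * U) p p := by
  have h1 : star U * U = 1 := Unitary.star_mul_self_of_mem hU
  have hcyc : (P * (U * diagonal g * star U)).trace = (star U * P * U * diagonal g).trace := by
    rw [← trace_unitary_conj (Unitary.star_mem hU) (P * (U * diagonal g * star U)), star_star]
    congr 1
    simp only [Matrix.mul_assoc]
    rw [h1, Matrix.mul_one]
  rw [hcyc, Matrix.trace]
  refine Finset.sum_congr rfl fun p _ => ?_
  rw [Matrix.diag_apply, Matrix.mul_diagonal, mul_comm]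

omit [DecidableEq d] in
/-- `(U⋆ P U)_{kk} = Σ_i conj(U_{ik}) (P u_k)_i`, so it vanishes when `P` kills the `k`-th column of `U`.
[folklore] -/
private theorem conj_apply_eq_zero_of_mulVec_col_eq_zero {P U : Matrix d d ℂ} {k : d}
    (h : P *ᵥ (fun q => U q k) = 0) : (star U * P * U) k k = 0 := by
  have : (star U * P * U) k k = ∑ i, star (U i k) * (P *ᵥ fun q => U q k) i := by
    simp only [Matrix.mul_apply, Matrix.star_apply, Matrix.mulVec, dotProduct, Finset.mul_sum, Finset.sum_mul,
      mul_assoc]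
    exact Finset.sum_comm
  rw [this, h]
  simp

/-- **`Tr(P log(σ + ε𝟙))` in the eigenbasis of `σ`**: `= Σ_k log(μ_k + ε) · (W⋆PW)_{kk}` for
`σ = W diag(μ) W⋆`. [cite: Watrous2018, §5.2.1 eq. (5.87) (eigen-coordinates of `Tr(P log Q)`)] -/
theorem trace_mul_log_add_smul_one_eq_sum {P σ W : Matrix d d ℂ} (hW : W ∈ Matrix.unitaryGroup d ℂ)
    {mu : d → ℝ} (hσW : σ = W * diagonal (fun k => ((mu k : ℝ) : ℂ)) * star W) (ε : ℝ) :
    (P * cfc Real.log (σ + ((ε : ℝ) : ℂ) • (1 : Matrix d d ℂ))).trace =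
      ∑ k, ((Real.log (mu k + ε) : ℝ) : ℂ) * (star W * P * W) k k := by
  rw [cfc_eq_conj_diagonal hW (conj_diagonal_add_smul_one hW hσW ε) Real.log,
    trace_mul_conj_diagonal_eq_sum' P W hW]
  rfl

/-- **Continuity of `ε ↦ Tr(P log(σ + ε𝟙))` at `0` under `ker σ ⊆ ker P`**: the weights on kernel
directions of `σ` vanish, all other eigenvalues are nonzero where `log` is continuous — the finite-
dimensional reason why `D(P‖Q)` with `im P ⊆ im Q` is the limit of its values at positive definite
`Q_ε = Q + ε𝟙`. [cite: Watrous2018, Definition 5.18 and eqs. (5.87)–(5.88)] -/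
theorem tendsto_re_trace_mul_log_add_smul_one {P σ : Matrix d d ℂ} (hσ : σ.IsHermitian)
    (hker : ∀ v : d → ℂ, σ *ᵥ v = 0 → P *ᵥ v = 0) :
    Tendsto (fun ε : ℝ => ((P * cfc Real.log (σ + ((ε : ℝ) : ℂ) • (1 : Matrix d d ℂ))).trace).re)
      (𝓝 0) (𝓝 ((P * cfc Real.log σ).trace).re) := by
  obtain ⟨W, hWdef⟩ : ∃ W : Matrix d d ℂ, W = (hσ.eigenvectorUnitary : Matrix d d ℂ) := ⟨_, rfl⟩
  have hW : W ∈ Matrix.unitaryGroup d ℂ := hWdef ▸ hσ.eigenvectorUnitary.2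
  have hσW : σ = W * diagonal (fun k => ((hσ.eigenvalues k : ℝ) : ℂ)) * star W := by
    rw [hWdef]; exact hσ.spectral_theorem
  -- the target, written at `ε = 0`
  have h0 : ((P * cfc Real.log σ).trace).re =
      (∑ k, ((Real.log (hσ.eigenvalues k + 0) : ℝ) : ℂ) * (star W * P * W) k k).re := by
    rw [← trace_mul_log_add_smul_one_eq_sum hW hσW 0, Complex.ofReal_zero, zero_smul, add_zero]
  rw [h0]
  simp_rw [trace_mul_log_add_smul_one_eq_sum hW hσW, Complex.re_sum]
  refine tendsto_finsetSum _ fun k _ => ?_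
  rcases eq_or_ne (hσ.eigenvalues k) 0 with hk | hk
  · -- kernel direction: the weight vanishes identically
    have hcol : σ *ᵥ (fun q => W q k) = 0 := by
      rw [mulVec_col_of_conj_diagonal hW hσW k, hk, Complex.ofReal_zero, zero_smul]
    have hr : (star W * P * W) k k = 0 := conj_apply_eq_zero_of_mulVec_col_eq_zero (hker _ hcol)
    simp only [hr, mul_zero]
    exact tendsto_const_nhds
  · -- `log` is continuous at `μ_k ≠ 0`
    have hc : ContinuousAt (fun ε : ℝ => ((((Real.log (hσ.eigenvalues k + ε) : ℝ) : ℂ)) *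
        (star W * P * W) k k).re) 0 := by
      have hlog : ContinuousAt (fun ε : ℝ => Real.log (hσ.eigenvalues k + ε)) 0 :=
        (Real.continuousAt_log (by simpa using hk)).comp (continuousAt_const.add continuousAt_id)
      exact Complex.continuous_re.continuousAt.comp
        ((Complex.continuous_ofReal.continuousAt.comp hlog).mul continuousAt_const)
    exact hc.tendsto

/-- **`D(P ‖ σ + ε𝟙) → D(P ‖ σ)` as `ε → 0⁺`** for Hermitian `P, σ` with `ker σ ⊆ ker P`.
[cite: Watrous2018, Definition 5.18 and eqs. (5.87)–(5.88)] -/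
theorem tendsto_quantumRelEntropy_add_smul_one_right {P σ : Matrix d d ℂ} (hσ : σ.IsHermitian)
    (hker : ∀ v : d → ℂ, σ *ᵥ v = 0 → P *ᵥ v = 0) :
    Tendsto (fun ε : ℝ => quantumRelEntropy P (σ + ((ε : ℝ) : ℂ) • (1 : Matrix d d ℂ))) (𝓝[>] 0)
      (𝓝 (quantumRelEntropy P σ)) := by
  unfold quantumRelEntropy
  simp_rw [Matrix.mul_sub, Matrix.trace_sub, Complex.sub_re]
  exact (tendsto_const_nhds.sub (tendsto_re_trace_mul_log_add_smul_one hσ hker)).mono_left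
    nhdsWithin_le_nhds

/-- **`D(ρ + δ𝟙 ‖ Q) → D(ρ ‖ Q)` as `δ → 0`** for Hermitian `ρ` and any `Q`: the first term
`Tr((ρ+δ𝟙) log(ρ+δ𝟙)) = Σ_j (λ_j + δ) log(λ_j + δ)` is continuous (`t log t` is), the second is
affine in `δ`. [cite: Watrous2018, §5.2.2 (continuity of the von Neumann entropy, eq. (5.92))] -/
theorem tendsto_quantumRelEntropy_add_smul_one_left {ρ : Matrix d d ℂ} (hρ : ρ.IsHermitian)
    (Q : Matrix d d ℂ) :
    Tendsto (fun δ : ℝ => quantumRelEntropy (ρ + ((δ : ℝ) : ℂ) • (1 : Matrix d d ℂ)) Q) (𝓝 0)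
      (𝓝 (quantumRelEntropy ρ Q)) := by
  obtain ⟨V, hVdef⟩ : ∃ V : Matrix d d ℂ, V = (hρ.eigenvectorUnitary : Matrix d d ℂ) := ⟨_, rfl⟩
  have hV : V ∈ Matrix.unitaryGroup d ℂ := hVdef ▸ hρ.eigenvectorUnitary.2
  have hρV : ρ = V * diagonal (fun j => ((hρ.eigenvalues j : ℝ) : ℂ)) * star V := by
    rw [hVdef]; exact hρ.spectral_theorem
  have key : ∀ δ : ℝ, quantumRelEntropy (ρ + ((δ : ℝ) : ℂ) • (1 : Matrix d d ℂ)) Q =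
      (∑ j, (hρ.eigenvalues j + δ) * Real.log (hρ.eigenvalues j + δ)) -
        (((ρ * cfc Real.log Q).trace).re + δ * ((cfc Real.log Q).trace).re) := by
    intro δ
    unfold quantumRelEntropy
    rw [Matrix.mul_sub, Matrix.trace_sub, Complex.sub_re,
      trace_mul_cfc_eq_sum hV (conj_diagonal_add_smul_one hV hρV δ) Real.log, Complex.ofReal_re,
      Matrix.add_mul, Matrix.trace_add, Complex.add_re, Matrix.smul_mul, Matrix.one_mul, Matrix.trace_smul,
      smul_eq_mul, Complex.re_ofReal_mul]
  have key0 : quantumRelEntropy ρ Q = (∑ j, (hρ.eigenvalues j + 0) * Real.log (hρ.eigenvalues j + 0)) -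
      (((ρ * cfc Real.log Q).trace).re + 0 * ((cfc Real.log Q).trace).re) := by
    rw [← key 0, Complex.ofReal_zero, zero_smul, add_zero]
  rw [key0]
  simp_rw [key]
  refine Tendsto.sub (tendsto_finsetSum _ fun j _ => ?_) (tendsto_const_nhds.add
    (tendsto_id.mul tendsto_const_nhds))
  have hc : Continuous fun δ : ℝ => (hρ.eigenvalues j + δ) * Real.log (hρ.eigenvalues j + δ) :=
    Real.continuous_mul_log.comp (continuous_const.add continuous_id)
  exact hc.tendsto 0

end Continuity

/-! ### §2 Monotonicity under the partial trace for positive semidefinite pairs with nested supports -/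

section PartialTrace

variable {m n : Type*} [Fintype m] [DecidableEq m] [Fintype n] [DecidableEq n]

omit [Fintype n] in
/-- `Tr_X 𝟙 = |X| · 𝟙`. [cite: NielsenChuang2010, §2.4.3 eq. (2.178)] -/
theorem traceLeft_one : traceLeft (1 : Matrix (m × n) (m × n) ℂ) = ((Fintype.card m : ℕ) : ℂ) • (1 : Matrix n n ℂ) := by
  rw [← one_kronecker_one, traceLeft_kronecker, Matrix.trace_one]

omit [Fintype m] in
/-- `Tr_Y 𝟙 = |Y| · 𝟙`. [cite: NielsenChuang2010, §2.4.3 eq. (2.178)] -/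
theorem traceRight_one : traceRight (1 : Matrix (m × n) (m × n) ℂ) = ((Fintype.card n : ℕ) : ℂ) • (1 : Matrix m m ℂ) := by
  rw [← one_kronecker_one, traceRight_kronecker, Matrix.trace_one]

omit [Fintype n] in
/-- `Tr_X (ρ + c𝟙) = Tr_X ρ + (c|X|) 𝟙`. [cite: NielsenChuang2010, §2.4.3 eq. (2.178)] -/
theorem traceLeft_add_smul_one (ρ : Matrix (m × n) (m × n) ℂ) (c : ℝ) :
    traceLeft (ρ + ((c : ℝ) : ℂ) • (1 : Matrix (m × n) (m × n) ℂ)) =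
      traceLeft ρ + ((c * Fintype.card m : ℝ) : ℂ) • (1 : Matrix n n ℂ) := by
  rw [traceLeft_add, traceLeft_smul, traceLeft_one, smul_smul]
  push_cast
  rfl

omit [Fintype m] in
/-- `Tr_Y (ρ + c𝟙) = Tr_Y ρ + (c|Y|) 𝟙`. [cite: NielsenChuang2010, §2.4.3 eq. (2.178)] -/
theorem traceRight_add_smul_one (ρ : Matrix (m × n) (m × n) ℂ) (c : ℝ) :
    traceRight (ρ + ((c : ℝ) : ℂ) • (1 : Matrix (m × n) (m × n) ℂ)) =
      traceRight ρ + ((c * Fintype.card n : ℝ) : ℂ) • (1 : Matrix m m ℂ) := by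
  rw [traceRight_add, traceRight_smul, traceRight_one, smul_smul]
  push_cast
  rfl

omit [DecidableEq n] in
/-- **Support transfer to the marginal**: if `σ ⪰ 0` and `ker σ ⊆ ker ρ` then `ker(Tr_X σ) ⊆ ker(Tr_X ρ)`
(a kernel vector `v` of `Tr_X σ` gives `σ(w ⊗ v) = 0`, hence `ρ(w ⊗ v) = 0`, for all `w`).
[cite: Watrous2018, Theorem 5.24 (proof, eq. (5.109))] -/
theorem ker_traceLeft_le {ρ σ : Matrix (m × n) (m × n) ℂ} (hσ : σ.PosSemidef)
    (hker : ∀ v : m × n → ℂ, σ *ᵥ v = 0 → ρ *ᵥ v = 0) :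
    ∀ v : n → ℂ, traceLeft σ *ᵥ v = 0 → traceLeft ρ *ᵥ v = 0 := by
  intro v hv
  have hslice : ∀ a : m, ρ *ᵥ (fun q : m × n => (Pi.single a (1 : ℂ) : m → ℂ) q.1 * v q.2) = 0 :=
    fun a => hker _ (mulVec_prod_eq_zero_of_traceLeft hσ hv _)
  funext b
  simp only [Matrix.mulVec, dotProduct, traceLeft_apply, Pi.zero_apply, Finset.sum_mul]
  rw [Finset.sum_comm]
  refine Finset.sum_eq_zero fun a _ => ?_
  have h := congrFun (hslice a) (a, b)
  simp only [Matrix.mulVec, dotProduct, Fintype.sum_prod_type, Pi.single_apply, Pi.zero_apply] at h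
  rw [Finset.sum_eq_single_of_mem a (Finset.mem_univ a)] at h
  · simpa using h
  · intro a' _ ha'
    simp [ha']

omit [DecidableEq m] in
/-- **Support transfer to the other marginal**: `ker(Tr_Y σ) ⊆ ker(Tr_Y ρ)`.
[cite: Watrous2018, Theorem 5.24 (proof, eq. (5.109))] -/
theorem ker_traceRight_le {ρ σ : Matrix (m × n) (m × n) ℂ} (hσ : σ.PosSemidef)
    (hker : ∀ v : m × n → ℂ, σ *ᵥ v = 0 → ρ *ᵥ v = 0) :
    ∀ v : m → ℂ, traceRight σ *ᵥ v = 0 → traceRight ρ *ᵥ v = 0 := by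
  intro v hv
  have hslice : ∀ b : n, ρ *ᵥ (fun q : m × n => v q.1 * (Pi.single b (1 : ℂ) : n → ℂ) q.2) = 0 :=
    fun b => hker _ (mulVec_prod_eq_zero_of_traceRight hσ hv _)
  funext a
  simp only [Matrix.mulVec, dotProduct, traceRight_apply, Pi.zero_apply, Finset.sum_mul]
  rw [Finset.sum_comm]
  refine Finset.sum_eq_zero fun b _ => ?_
  have h := congrFun (hslice b) (a, b)
  simp only [Matrix.mulVec, dotProduct, Fintype.sum_prod_type, Pi.single_apply, Pi.zero_apply] at h
  rw [Finset.sum_comm, Finset.sum_eq_single_of_mem b (Finset.mem_univ b)] at h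
  · simpa using h
  · intro b' _ hb'
    simp [hb']

/-- `ρ + δ𝟙 ≻ 0` for `ρ ⪰ 0` and `δ > 0`. [folklore] -/
private theorem posDef_add_smul_one {k : Type*} [Fintype k] [DecidableEq k] {ρ : Matrix k k ℂ}
    (hρ : ρ.PosSemidef) {δ : ℝ} (hδ : 0 < δ) : (ρ + ((δ : ℝ) : ℂ) • (1 : Matrix k k ℂ)).PosDef :=
  Matrix.PosDef.posSemidef_add hρ (Matrix.PosDef.one.smul (Complex.zero_lt_real.mpr hδ))

/-- **Monotonicity of the quantum relative entropy under `Tr_X`, positive semidefinite pairs with nested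
supports** (Lindblad 1975; Watrous Theorem 5.35 for the partial trace): for `ρ, σ ⪰ 0` on `ℋ_X ⊗ ℋ_Y`
with `ker σ ⊆ ker ρ`, `D(Tr_X ρ ‖ Tr_X σ) ≤ D(ρ‖σ)`. From the tree's positive definite case
(`re_trace_traceLeft_mul_log_sub_log_le`) at `(ρ + δ𝟙, σ + ε𝟙)`, letting `δ → 0` and then `ε → 0⁺`.
[cite: Lindblad1975, Lemma 2 p.149] [cite: Watrous2018, Theorem 5.35] -/
theorem quantumRelEntropy_traceLeft_le_of_ker_le {ρ σ : Matrix (m × n) (m × n) ℂ} (hρ : ρ.PosSemidef)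
    (hσ : σ.PosSemidef) (hker : ∀ v : m × n → ℂ, σ *ᵥ v = 0 → ρ *ᵥ v = 0) :
    quantumRelEntropy (traceLeft ρ) (traceLeft σ) ≤ quantumRelEntropy ρ σ := by
  rcases isEmpty_or_nonempty m with hm | hm
  · -- `ℋ_X = 0`: both sides vanish
    have h0 : traceLeft ρ = 0 := by ext b b'; simp [traceLeft_apply]
    have h1 : quantumRelEntropy ρ σ = 0 := by simp [quantumRelEntropy, Matrix.trace]
    rw [h0, h1]
    simp [quantumRelEntropy]
  have hpos : (0 : ℝ) < Fintype.card m := Nat.cast_pos.2 Fintype.card_pos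
  have hρX : (traceLeft ρ).IsHermitian := (posSemidef_traceLeft hρ).1
  have hσX : (traceLeft σ).IsHermitian := (posSemidef_traceLeft hσ).1
  -- step 1: positive definite regularisation of both arguments
  have hA : ∀ {δ ε : ℝ}, 0 < δ → 0 < ε →
      quantumRelEntropy (traceLeft ρ + ((δ * Fintype.card m : ℝ) : ℂ) • (1 : Matrix n n ℂ))
          (traceLeft σ + ((ε * Fintype.card m : ℝ) : ℂ) • (1 : Matrix n n ℂ)) ≤
        quantumRelEntropy (ρ + ((δ : ℝ) : ℂ) • 1) (σ + ((ε : ℝ) : ℂ) • 1) := by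
    intro δ ε hδ hε
    have h := re_trace_traceLeft_mul_log_sub_log_le (posDef_add_smul_one hρ hδ) (posDef_add_smul_one hσ hε)
    rw [traceLeft_add_smul_one, traceLeft_add_smul_one] at h
    exact h
  -- step 2: `δ → 0⁺` at fixed `ε > 0`
  have hB : ∀ {ε : ℝ}, 0 < ε →
      quantumRelEntropy (traceLeft ρ) (traceLeft σ + ((ε * Fintype.card m : ℝ) : ℂ) • (1 : Matrix n n ℂ)) ≤
        quantumRelEntropy ρ (σ + ((ε : ℝ) : ℂ) • 1) := by
    intro ε hε
    have hlim1 : Tendsto (fun δ : ℝ => quantumRelEntropy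
        (traceLeft ρ + ((δ * Fintype.card m : ℝ) : ℂ) • (1 : Matrix n n ℂ))
        (traceLeft σ + ((ε * Fintype.card m : ℝ) : ℂ) • (1 : Matrix n n ℂ))) (𝓝[>] 0)
        (𝓝 (quantumRelEntropy (traceLeft ρ)
          (traceLeft σ + ((ε * Fintype.card m : ℝ) : ℂ) • (1 : Matrix n n ℂ)))) := by
      have hmul : Tendsto (fun δ : ℝ => δ * Fintype.card m) (𝓝 0) (𝓝 0) := by
        have hc : Continuous fun δ : ℝ => δ * Fintype.card m := continuous_id.mul continuous_const
        simpa using hc.tendsto 0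
      exact ((tendsto_quantumRelEntropy_add_smul_one_left hρX _).comp hmul).mono_left nhdsWithin_le_nhds
    have hlim2 : Tendsto (fun δ : ℝ => quantumRelEntropy (ρ + ((δ : ℝ) : ℂ) • 1) (σ + ((ε : ℝ) : ℂ) • 1))
        (𝓝[>] 0) (𝓝 (quantumRelEntropy ρ (σ + ((ε : ℝ) : ℂ) • 1))) :=
      (tendsto_quantumRelEntropy_add_smul_one_left hρ.1 _).mono_left nhdsWithin_le_nhds
    refine le_of_tendsto_of_tendsto hlim1 hlim2 ?_
    filter_upwards [self_mem_nhdsWithin] with δ hδ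
    exact hA hδ hε
  -- step 3: `ε → 0⁺`
  have hlim3 : Tendsto (fun ε : ℝ => quantumRelEntropy (traceLeft ρ)
      (traceLeft σ + ((ε * Fintype.card m : ℝ) : ℂ) • (1 : Matrix n n ℂ))) (𝓝[>] 0)
      (𝓝 (quantumRelEntropy (traceLeft ρ) (traceLeft σ))) := by
    have hmul : Tendsto (fun ε : ℝ => ε * Fintype.card m) (𝓝[>] 0) (𝓝[>] 0) := by
      refine tendsto_nhdsWithin_of_tendsto_nhds_of_eventually_within _ ?_ ?_
      · have hc : Continuous fun ε : ℝ => ε * Fintype.card m := continuous_id.mul continuous_const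
        simpa using (hc.tendsto 0).mono_left nhdsWithin_le_nhds
      · filter_upwards [self_mem_nhdsWithin] with ε hε
        exact mul_pos hε hpos
    exact (tendsto_quantumRelEntropy_add_smul_one_right hσX (ker_traceLeft_le hσ hker)).comp hmul
  have hlim4 := tendsto_quantumRelEntropy_add_smul_one_right (P := ρ) hσ.1 hker
  refine le_of_tendsto_of_tendsto hlim3 hlim4 ?_
  filter_upwards [self_mem_nhdsWithin] with ε hε
  exact hB hε

/-- **Monotonicity under `Tr_Y`** (the other factor), positive semidefinite pairs with nested supports:
`D(Tr_Y ρ ‖ Tr_Y σ) ≤ D(ρ‖σ)` (by the swap `ℋ_X ⊗ ℋ_Y ≃ ℋ_Y ⊗ ℋ_X`).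
[cite: Lindblad1975, Lemma 2 p.149] [cite: Watrous2018, Theorem 5.35] -/
theorem quantumRelEntropy_traceRight_le_of_ker_le {ρ σ : Matrix (m × n) (m × n) ℂ} (hρ : ρ.PosSemidef)
    (hσ : σ.PosSemidef) (hker : ∀ v : m × n → ℂ, σ *ᵥ v = 0 → ρ *ᵥ v = 0) :
    quantumRelEntropy (traceRight ρ) (traceRight σ) ≤ quantumRelEntropy ρ σ := by
  set e : n × m → m × n := Prod.swap with he
  have hρ' : (ρ.submatrix e e).PosSemidef := hρ.submatrix e
  have hσ' : (σ.submatrix e e).PosSemidef := hσ.submatrix e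
  have hker' : ∀ v : n × m → ℂ, σ.submatrix e e *ᵥ v = 0 → ρ.submatrix e e *ᵥ v = 0 := by
    intro v hv
    have h1 : ∀ (M : Matrix (m × n) (m × n) ℂ), M.submatrix e e *ᵥ v = (M *ᵥ (v ∘ Prod.swap)) ∘ e := by
      intro M
      funext q
      simp only [Matrix.mulVec, dotProduct, Matrix.submatrix_apply, Function.comp_apply, he]
      exact Fintype.sum_equiv (Equiv.prodComm n m) _ _ fun _ => rfl
    rw [h1] at hv ⊢
    have hv' : σ *ᵥ (v ∘ Prod.swap) = 0 := by
      funext q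
      have := congrFun hv q.swap
      simpa [he] using this
    have := hker _ hv'
    rw [this]
    rfl
  have h := quantumRelEntropy_traceLeft_le_of_ker_le hρ' hσ' hker'
  rwa [traceLeft_submatrix_swap, traceLeft_submatrix_swap,
    show quantumRelEntropy (ρ.submatrix e e) (σ.submatrix e e) = quantumRelEntropy ρ σ from by
      unfold quantumRelEntropy
      rw [he, show (Prod.swap : n × m → m × n) = (Equiv.prodComm n m) from rfl,
        trace_submatrix_mul_log_sub_log hρ.1 hσ.1]] at h

end PartialTrace

/-! ### §3 Monotonicity under channels (Watrous Theorem 5.35) -/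

section Channel

variable {m n ι : Type*} [Fintype m] [DecidableEq m] [Fintype n] [DecidableEq n] [Fintype ι] [DecidableEq ι]

omit [DecidableEq m] [Fintype n] [DecidableEq n] in
/-- **Support transfer along a Stinespring dilation**: for `σ ⪰ 0` with `ker σ ⊆ ker ρ` and any `V`,
`ker(VσV⋆) ⊆ ker(VρV⋆)` (`VσV⋆v = 0 ⟹ ⟨V⋆v, σV⋆v⟩ = 0 ⟹ σV⋆v = 0`). [cite: Watrous2018, Theorem 5.35 (proof, eq. (5.177))] -/
theorem ker_conj_le {p : Type*} [Fintype p] (V : Matrix p m ℂ) {ρ σ : Matrix m m ℂ} (hσ : σ.PosSemidef)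
    (hker : ∀ v : m → ℂ, σ *ᵥ v = 0 → ρ *ᵥ v = 0) :
    ∀ v : p → ℂ, (V * σ * Vᴴ) *ᵥ v = 0 → (V * ρ * Vᴴ) *ᵥ v = 0 := by
  intro v hv
  have hq : star (Vᴴ *ᵥ v) ⬝ᵥ (σ *ᵥ (Vᴴ *ᵥ v)) = 0 := by
    have h := congrArg (fun w => star v ⬝ᵥ w) hv
    simp only [dotProduct_zero] at h
    rwa [← Matrix.mulVec_mulVec, ← Matrix.mulVec_mulVec, Matrix.dotProduct_mulVec, ← conjTranspose_conjTranspose V,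
      ← Matrix.star_mulVec, conjTranspose_conjTranspose] at h
  have hσv : σ *ᵥ (Vᴴ *ᵥ v) = 0 := (hσ.dotProduct_mulVec_zero_iff _).1 hq
  rw [← Matrix.mulVec_mulVec, ← Matrix.mulVec_mulVec, hker _ hσv, Matrix.mulVec_zero]

/-- **Watrous Theorem 5.35 (monotonicity of the quantum relative entropy under channels)**, Kraus form:
for a channel `Φ(X) = Σ_s A_s X A_s⋆` (`Σ_s A_s⋆A_s = 𝟙`) and `ρ, σ ⪰ 0` with `ker σ ⊆ ker ρ` (the
finite case of the source's `D`), `D(Φ(ρ)‖Φ(σ)) ≤ D(ρ‖σ)`. Proof as printed ((5.175)–(5.179)) with the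
partial trace in place of `𝟙 ⊗ Ω`: the Stinespring isometry `A = Σ_s A_s ⊗ e_s` (tree
`StinespringRepresentations`), `D(AρA⋆‖AσA⋆) = D(ρ‖σ)` (Proposition 5.19, `quantumRelEntropy_isometry_conj`),
and monotonicity under `Tr_𝒵` for the nested-support pair `(AρA⋆, AσA⋆)`.
[cite: Watrous2018, Theorem 5.35] [cite: Lindblad1975, Theorem p.149] -/
theorem quantumRelEntropy_kraus_le (A : ι → Matrix n m ℂ) (hA : ∑ s, (A s)ᴴ * A s = 1)
    {ρ σ : Matrix m m ℂ} (hρ : ρ.PosSemidef) (hσ : σ.PosSemidef)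
    (hker : ∀ v : m → ℂ, σ *ᵥ v = 0 → ρ *ᵥ v = 0) :
    quantumRelEntropy (∑ s, A s * ρ * (A s)ᴴ) (∑ s, A s * σ * (A s)ᴴ) ≤ quantumRelEntropy ρ σ := by
  set V : Matrix (n × ι) m ℂ := Matrix.of fun (y : n × ι) x => A y.2 y.1 x with hV
  have hVV : Vᴴ * V = 1 := (stinespring_isometry_iff A).2 hA
  have hΦ : ∀ X : Matrix m m ℂ, ∑ s, A s * X * (A s)ᴴ = traceRight (V * X * Vᴴ) := fun X =>
    (traceRight_stack_mul_mul_conjTranspose_stack A A X).symm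
  rw [hΦ, hΦ]
  calc quantumRelEntropy (traceRight (V * ρ * Vᴴ)) (traceRight (V * σ * Vᴴ))
      ≤ quantumRelEntropy (V * ρ * Vᴴ) (V * σ * Vᴴ) :=
        quantumRelEntropy_traceRight_le_of_ker_le (hρ.mul_mul_conjTranspose_same V)
          (hσ.mul_mul_conjTranspose_same V) (ker_conj_le V hσ hker)
    _ = quantumRelEntropy ρ σ := quantumRelEntropy_isometry_conj V hVV hρ.1 hσ.1

/-- **Theorem 5.35 for states**: for a channel `Φ` in Kraus form, a density `ρ` and a positive definite
density `σ`, `D(Φ(ρ)‖Φ(σ)) ≤ D(ρ‖σ)`. [cite: Watrous2018, Theorem 5.35] [cite: NielsenChuang2010, Theorem 11.17 (and §11.3.6)] -/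
theorem quantumRelEntropy_kraus_le_of_posDef (A : ι → Matrix n m ℂ) (hA : ∑ s, (A s)ᴴ * A s = 1)
    {ρ σ : Matrix m m ℂ} (hρ : IsDensity ρ) (hσ : σ.PosDef) :
    quantumRelEntropy (∑ s, A s * ρ * (A s)ᴴ) (∑ s, A s * σ * (A s)ᴴ) ≤ quantumRelEntropy ρ σ :=
  quantumRelEntropy_kraus_le A hA hρ.1 hσ.posSemidef (ker_le_of_posDef hσ)

/-- **Monotonicity under the partial trace for states** (Nielsen–Chuang Theorem 11.17) with the support
hypothesis in place of `σ ≻ 0`: `D(ρ^A‖σ^A) ≤ D(ρ^{AB}‖σ^{AB})` whenever `im ρ ⊆ im σ`; the tree's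
`relEntropy_partialTrace_le` is the case `σ ≻ 0`. [cite: NielsenChuang2010, Theorem 11.17 eq. (11.125)]
[cite: Lindblad1975, Lemma 2 p.149] -/
theorem quantumRelEntropy_partialTrace_le_of_ker_le {ρ σ : Matrix (m × n) (m × n) ℂ} (hρ : ρ.PosSemidef)
    (hσ : σ.PosSemidef) (hker : ∀ v : m × n → ℂ, σ *ᵥ v = 0 → ρ *ᵥ v = 0) :
    quantumRelEntropy (traceLeft ρ) (traceLeft σ) ≤ quantumRelEntropy ρ σ ∧
      quantumRelEntropy (traceRight ρ) (traceRight σ) ≤ quantumRelEntropy ρ σ :=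
  ⟨quantumRelEntropy_traceLeft_le_of_ker_le hρ hσ hker, quantumRelEntropy_traceRight_le_of_ker_le hρ hσ hker⟩

end Channel

end Literature.InformationTheory.Entropy
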